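import Summits.CriticalPhenomena.SAWScalingLimit.Theorems.ConfinementPositivity.Negative.LoadBearing
import Summits.CriticalPhenomena.SAWScalingLimit.Theorems.ShellCrossingBound.Negative.Forcing2Lattice

/-!
# `ConfinementPositivity` (stmt-CriticalPhenomena-17587) — negative knowledge, cusp series 2/4: lattice domains of graph strips

Refuter crux-attack support file (cdisprove).  Generic lattice bookkeeping for planar domains
of "graph-strip" type
`Ω = {0 < x < 1, lo x < y < hi x}` with `lo < 0 < hi` on `(0,1)`, `hi` non-decreasing and `lo`
non-increasing on `[0,1]` (both witness domains of the cusp series are of this type: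
`hi x = x²/16`, `lo x = -x²/16` resp. `lo x = -1`):

* `strip_vec_mem_iff` — membership of a lattice site in `Ω ∩ δℤ²`;
* `strip_meshGraph_adj` — neighbouring lattice sites of `Ω` are joined in the mesh graph (the
  closed edge lies in `Ω`: vertical sections are intervals, horizontal edges stay below the
  non-decreasing `hi` and above the non-increasing `lo`);
* `strip_preconnected`, `strip_meshDomain_eq` — the mesh vertex graph is preconnected (walk down
  to the axis, then along the axis to `(1, 0)`), so the discrete domain `Ω_δ` is ALL of
  `Ω ∩ δℤ²` (no largest-component effect), and `strip_dd_adj_iff`, `strip_dd_reachable`;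
* `strip_isEndpointApprox` — for a Dobrushin domain with such a carrier marked at `0` and `1`,
  `a_δ = (1, 0)` and `b_δ = (⌈δ⁻¹⌉ - 1, 0)` form an honest endpoint approximation.

Def-free helper; everything proved, standard axioms. [folklore]
-/

noncomputable section

namespace Summit.CriticalPhenomena.SAWScalingLimit.Theorems.ConfinementPositivity.Negative

open Set Metric Filter Topology Complex
open Literature.Probability.RandomPlanarGeometry Literature.Probability.LatticeModels
open Summit.CriticalPhenomena.SAWScalingLimit.Theorems.SubseqIdentification.Negative
open Summit.CriticalPhenomena.SAWScalingLimit.Theorems.ShellCrossingBound.Negative.Forcing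
  (meshPoint_vec vec_add_single_zero vec_add_single_one eq_vec)

section Strip

variable {Ω : Set ℂ} {lo hi : ℝ → ℝ} {δ : ℝ}
  (hΩ : ∀ z : ℂ, z ∈ Ω ↔ 0 < z.re ∧ z.re < 1 ∧ lo z.re < z.im ∧ z.im < hi z.re)
  (hsign : ∀ x : ℝ, 0 < x → x < 1 → lo x < 0 ∧ 0 < hi x)
  (hhi : MonotoneOn hi (Icc 0 1)) (hlo : AntitoneOn lo (Icc 0 1)) (hδ : 0 < δ)

include hΩ in
/-- Membership of a lattice site in the mesh vertices of a graph strip. [folklore] -/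
theorem strip_vec_mem_iff (δ : ℝ) (i j : ℤ) :
    (![i, j] : Site 2) ∈ meshVertices Ω δ ↔
      0 < δ * i ∧ δ * i < 1 ∧ lo (δ * i) < δ * j ∧ δ * j < hi (δ * i) := by
  rw [mem_meshVertices_iff, meshPoint_vec, hΩ]

include hΩ in
/-- Membership of a general site (coordinates form). [folklore] -/
theorem strip_mem_iff (δ : ℝ) (x : Site 2) :
    x ∈ meshVertices Ω δ ↔
      0 < δ * x 0 ∧ δ * x 0 < 1 ∧ lo (δ * x 0) < δ * x 1 ∧ δ * x 1 < hi (δ * x 0) := by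
  conv_lhs => rw [eq_vec x]
  exact strip_vec_mem_iff hΩ δ (x 0) (x 1)

include hΩ hδ in
/-- A mesh vertex has positive abscissa index. [folklore] -/
theorem strip_pos_of_mem {x : Site 2} (hx : x ∈ meshVertices Ω δ) : 1 ≤ x 0 := by
  rw [strip_mem_iff hΩ] at hx
  have h : (0 : ℝ) < x 0 := pos_of_mul_pos_right hx.1 hδ.le
  exact_mod_cast Int.add_one_le_of_lt (by exact_mod_cast h : (0 : ℤ) < x 0)

include hΩ hhi hlo hδ in
/-- **Edges.** Two `ℤ²`-neighbours that are mesh vertices of a graph strip are joined in its mesh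
graph: the closed edge lies in `Ω` (vertical sections are intervals; a horizontal edge at height
`y` with both ends in `Ω` stays in `Ω` because `hi` does not decrease and `lo` does not
increase along it). [folklore] -/
theorem strip_meshGraph_adj {x y : Site 2} (hx : x ∈ meshVertices Ω δ)
    (hy : y ∈ meshVertices Ω δ) (hxy : (zdGraph 2).Adj x y) : (meshGraph Ω δ).Adj x y := by
  -- reduce to `y = x + eᵢ`
  wlog h : ∃ i, y = x + Pi.single i 1 generalizing x y
  · obtain ⟨i, hi | hi⟩ := (zdGraph_adj_iff _ _).1 hxy
    · exact this hx hy hxy ⟨i, hi⟩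
    · exact (this hy hx hxy.symm ⟨i, hi⟩).symm
  obtain ⟨i, rfl⟩ := h
  refine meshGraph_adj_iff.2 ⟨hxy, fun p hp => subset_closure ?_⟩
  rw [segment_eq_image'] at hp
  obtain ⟨θ, ⟨hθ0, hθ1⟩, rfl⟩ := hp
  rw [strip_mem_iff hΩ] at hx hy
  rw [hΩ]
  have hi2 : i = 0 ∨ i = 1 := by fin_cases i <;> simp
  rcases hi2 with rfl | rfl
  · -- horizontal edge
    have hy0 : ((x + Pi.single 0 1 : Site 2) 0) = x 0 + 1 := by simp
    have hy1 : ((x + Pi.single 0 1 : Site 2) 1) = x 1 := by simp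
    rw [hy0, hy1] at hy
    push_cast at hy
    have ere : (meshPoint δ x + θ • (meshPoint δ (x + Pi.single 0 1) - meshPoint δ x)).re =
        δ * x 0 + θ * δ := by
      rw [Complex.add_re, Complex.real_smul, Complex.re_ofReal_mul, Complex.sub_re, meshPoint_re,
        meshPoint_re, hy0]
      push_cast
      ring
    have eim : (meshPoint δ x + θ • (meshPoint δ (x + Pi.single 0 1) - meshPoint δ x)).im =
        δ * x 1 := by
      rw [Complex.add_im, Complex.real_smul, Complex.im_ofReal_mul, Complex.sub_im, meshPoint_im,
        meshPoint_im, hy1]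
      ring
    rw [ere, eim]
    have hδx : δ * ↑(x 0) + θ * δ ∈ Icc (0 : ℝ) 1 := ⟨by nlinarith [hx.1], by nlinarith [hy.2.1]⟩
    have hx0 : δ * ↑(x 0) ∈ Icc (0 : ℝ) 1 := ⟨hx.1.le, hx.2.1.le⟩
    have hle : δ * ↑(x 0) ≤ δ * ↑(x 0) + θ * δ := by nlinarith
    refine ⟨by nlinarith [hx.1], by nlinarith [hy.2.1], ?_, ?_⟩
    · exact (hlo hx0 hδx hle).trans_lt hx.2.2.1
    · exact hx.2.2.2.trans_le (hhi hx0 hδx hle)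
  · -- vertical edge
    have hy0 : ((x + Pi.single 1 1 : Site 2) 0) = x 0 := by simp
    have hy1 : ((x + Pi.single 1 1 : Site 2) 1) = x 1 + 1 := by simp
    rw [hy0, hy1] at hy
    push_cast at hy
    have ere : (meshPoint δ x + θ • (meshPoint δ (x + Pi.single 1 1) - meshPoint δ x)).re =
        δ * x 0 := by
      rw [Complex.add_re, Complex.real_smul, Complex.re_ofReal_mul, Complex.sub_re, meshPoint_re,
        meshPoint_re, hy0]
      ring
    have eim : (meshPoint δ x + θ • (meshPoint δ (x + Pi.single 1 1) - meshPoint δ x)).im =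
        δ * x 1 + θ * δ := by
      rw [Complex.add_im, Complex.real_smul, Complex.im_ofReal_mul, Complex.sub_im, meshPoint_im,
        meshPoint_im, hy1]
      push_cast
      ring
    rw [ere, eim]
    exact ⟨hx.1, hx.2.1, by nlinarith [hx.2.2.1], by nlinarith [hy.2.2.2]⟩

include hΩ hsign in
/-- The axis site `(i, 0)` with `0 < δ i < 1` is a mesh vertex. [folklore] -/
theorem strip_axis_mem {i : ℤ} (h0 : 0 < δ * i) (h1 : δ * i < 1) :
    (![i, 0] : Site 2) ∈ meshVertices Ω δ := by
  rw [strip_vec_mem_iff hΩ]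
  have := hsign _ h0 h1
  simp only [Int.cast_zero, mul_zero]
  exact ⟨h0, h1, this.1, this.2⟩

include hΩ hsign hδ in
/-- The base site `(1, 0)` is a mesh vertex for `δ < 1`. [folklore] -/
theorem strip_one_mem (hδ1 : δ < 1) : (![1, 0] : Site 2) ∈ meshVertices Ω δ :=
  strip_axis_mem hΩ hsign (i := 1) (by simpa using hδ) (by simpa using hδ1)

include hΩ hsign hδ in
/-- **One step towards `(1, 0)`** inside the mesh vertices: from `(m, n)` with `n ≠ 0` move
vertically towards the axis (the vertical section is an interval containing `0`), from `(m, 0)`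
with `m > 1` move left along the axis. The potential `|m - 1| + |n|` drops. [folklore] -/
theorem strip_exists_step {x : Site 2} (hx : x ∈ meshVertices Ω δ) (hne : x ≠ ![1, 0]) :
    ∃ y : Site 2, y ∈ meshVertices Ω δ ∧ (zdGraph 2).Adj x y ∧
      (y 0 - 1).natAbs + (y 1).natAbs < (x 0 - 1).natAbs + (x 1).natAbs := by
  have hx' := (strip_mem_iff hΩ δ x).1 hx
  have hs := hsign _ hx'.1 hx'.2.1
  have h1 : 1 ≤ x 0 := strip_pos_of_mem hΩ hδ hx
  by_cases hn : x 1 = 0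
  · -- on the axis: move left
    have hm : x 0 ≠ 1 := by
      intro hm; apply hne; rw [eq_vec x, hm, hn]
    have hm2 : 2 ≤ x 0 := by omega
    refine ⟨x - Pi.single 0 1, ?_, (zdGraph_adj_iff _ _).2 ⟨0, Or.inr (by simp)⟩, ?_⟩
    · rw [strip_mem_iff hΩ]
      simp only [Pi.sub_apply, Pi.single_eq_same, Int.cast_sub, Int.cast_one, ne_eq,
        one_ne_zero, not_false_eq_true, Pi.single_eq_of_ne, sub_zero, hn, Int.cast_zero,
        mul_zero]
      have h0' : 0 < δ * (↑(x 0) - 1) := by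
        have : (2 : ℝ) ≤ x 0 := by exact_mod_cast hm2
        nlinarith
      have h1' : δ * (↑(x 0) - 1) < 1 := by nlinarith [hx'.2.1]
      have := hsign _ h0' h1'
      exact ⟨h0', h1', this.1, this.2⟩
    · simp only [Pi.sub_apply, Pi.single_eq_same, ne_eq, one_ne_zero, not_false_eq_true,
        Pi.single_eq_of_ne, sub_zero, hn]
      omega
  · rcases lt_or_gt_of_ne hn with hneg | hpos
    · -- below the axis: move up
      refine ⟨x + Pi.single 1 1, ?_, (zdGraph_adj_iff _ _).2 ⟨1, Or.inl rfl⟩, ?_⟩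
      · rw [strip_mem_iff hΩ]
        simp only [Pi.add_apply, ne_eq, zero_ne_one, not_false_eq_true, Pi.single_eq_of_ne,
          add_zero, Pi.single_eq_same, Int.cast_add, Int.cast_one]
        have : (x 1 : ℝ) + 1 ≤ 0 := by exact_mod_cast Int.add_one_le_of_lt hneg
        refine ⟨hx'.1, hx'.2.1, by nlinarith [hx'.2.2.1], ?_⟩
        nlinarith [hs.2]
      · simp only [Pi.add_apply, ne_eq, zero_ne_one, not_false_eq_true, Pi.single_eq_of_ne,
          add_zero, Pi.single_eq_same]
        omega
    · -- above the axis: move down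
      refine ⟨x - Pi.single 1 1, ?_, (zdGraph_adj_iff _ _).2 ⟨1, Or.inr (by simp)⟩, ?_⟩
      · rw [strip_mem_iff hΩ]
        simp only [Pi.sub_apply, ne_eq, zero_ne_one, not_false_eq_true, Pi.single_eq_of_ne,
          sub_zero, Pi.single_eq_same, Int.cast_sub, Int.cast_one]
        have : (1 : ℝ) ≤ x 1 := by exact_mod_cast hpos
        refine ⟨hx'.1, hx'.2.1, ?_, by nlinarith [hx'.2.2.2]⟩
        nlinarith [hs.1]
      · simp only [Pi.sub_apply, ne_eq, zero_ne_one, not_false_eq_true, Pi.single_eq_of_ne,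
          sub_zero, Pi.single_eq_same]
        omega

include hΩ hsign hhi hlo hδ in
/-- Every mesh vertex of a graph strip is joined to `(1, 0)` inside the mesh vertex graph.
[folklore] -/
theorem strip_reachable_one (hδ1 : δ < 1) : ∀ (n : ℕ) (x : Site 2) (hx : x ∈ meshVertices Ω δ),
    (x 0 - 1).natAbs + (x 1).natAbs = n →
    (meshVertexGraph Ω δ).Reachable ⟨x, hx⟩ ⟨![1, 0], strip_one_mem hΩ hsign hδ hδ1⟩ := by
  intro n
  induction n using Nat.strong_induction_on with
  | _ n ih =>
    intro x hx hn
    by_cases h0 : x = ![1, 0]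
    · subst h0; rfl
    obtain ⟨y, hy, hadj, hlt⟩ := strip_exists_step hΩ hsign hδ hx h0
    have h1 : (meshVertexGraph Ω δ).Adj ⟨x, hx⟩ ⟨y, hy⟩ := by
      simp only [SimpleGraph.comap_adj, Function.Embedding.subtype_apply]
      exact strip_meshGraph_adj hΩ hhi hlo hδ hx hy hadj
    exact h1.reachable.trans (ih _ (hn ▸ hlt) y hy rfl)

include hΩ hsign hhi hlo hδ in
/-- The mesh vertex graph of a graph strip is preconnected. [folklore] -/
theorem strip_preconnected (hδ1 : δ < 1) : (meshVertexGraph Ω δ).Preconnected := fun u v =>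
  (strip_reachable_one hΩ hsign hhi hlo hδ hδ1 _ u.1 u.2 rfl).trans
    (strip_reachable_one hΩ hsign hhi hlo hδ hδ1 _ v.1 v.2 rfl).symm

include hΩ hsign hhi hlo hδ in
/-- **No largest-component effect**: the discrete domain `Ω_δ` of a graph strip is all of
`Ω ∩ δℤ²`. [folklore] -/
theorem strip_mem_meshDomain (hδ1 : δ < 1) {x : Site 2} (hx : x ∈ meshVertices Ω δ) :
    x ∈ meshDomain Ω δ := by
  have hsub := (strip_preconnected hΩ hsign hhi hlo hδ hδ1).subsingleton_connectedComponent
  simp only [meshDomain, Set.mem_iUnion, Set.mem_image]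
  refine ⟨(meshVertexGraph Ω δ).connectedComponentMk ⟨x, hx⟩, fun C' => ?_, ⟨x, hx⟩, ?_, rfl⟩
  · rw [Subsingleton.elim C' ((meshVertexGraph Ω δ).connectedComponentMk ⟨x, hx⟩)]
  · rw [SimpleGraph.ConnectedComponent.mem_supp_iff]

include hΩ hsign hhi hlo hδ in
/-- The discrete domain of a graph strip equals its mesh vertex set. [folklore] -/
theorem strip_meshDomain_eq (hδ1 : δ < 1) : meshDomain Ω δ = meshVertices Ω δ :=
  Subset.antisymm (meshDomain_subset_meshVertices Ω δ)
    fun _ hx => strip_mem_meshDomain hΩ hsign hhi hlo hδ hδ1 hx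

include hΩ hsign hhi hlo hδ in
/-- **Adjacency in `Ω_δ`** for a graph strip: `ℤ²`-neighbours, both in `Ω`. [folklore] -/
theorem strip_dd_adj_iff (hδ1 : δ < 1) {x y : Site 2} :
    (discreteDomainGraph Ω δ).Adj x y ↔
      (zdGraph 2).Adj x y ∧ x ∈ meshVertices Ω δ ∧ y ∈ meshVertices Ω δ := by
  rw [discreteDomainGraph_adj_iff, strip_meshDomain_eq hΩ hsign hhi hlo hδ hδ1]
  constructor
  · rintro ⟨h, hx, hy⟩
    exact ⟨meshGraph_le_zdGraph _ _ h, hx, hy⟩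
  · rintro ⟨h, hx, hy⟩
    exact ⟨strip_meshGraph_adj hΩ hhi hlo hδ hx hy h, hx, hy⟩

include hΩ hsign hhi hlo hδ in
/-- Any two mesh vertices of a graph strip are joined in `Ω_δ`. [folklore] -/
theorem strip_dd_reachable (hδ1 : δ < 1) {x y : Site 2} (hx : x ∈ meshVertices Ω δ)
    (hy : y ∈ meshVertices Ω δ) : (discreteDomainGraph Ω δ).Reachable x y := by
  let hom : meshVertexGraph Ω δ →g discreteDomainGraph Ω δ :=
    { toFun := Subtype.val
      map_rel' := fun {u v} h => discreteDomainGraph_adj_iff.2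
        ⟨h, strip_mem_meshDomain hΩ hsign hhi hlo hδ hδ1 u.2,
          strip_mem_meshDomain hΩ hsign hhi hlo hδ hδ1 v.2⟩ }
  exact (strip_preconnected hΩ hsign hhi hlo hδ hδ1 ⟨x, hx⟩ ⟨y, hy⟩).map hom

end Strip

/-! ### The honest endpoint approximation of a graph strip marked at `0` and `1` -/

/-- The honest right endpoint `(⌈δ⁻¹⌉ - 1, 0)` is an axis site with abscissa in `[1 - δ, 1)`,
hence a mesh vertex of every graph strip for `δ < 1`. [folklore] -/
theorem stdA_bounds {δ : ℝ} (hδ : 0 < δ) (hδ1 : δ < 1) :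
    0 < δ * ((⌈δ⁻¹⌉ - 1 : ℤ) : ℝ) ∧ δ * ((⌈δ⁻¹⌉ - 1 : ℤ) : ℝ) < 1 := by
  have h := near_bounds hδ
  exact ⟨by linarith [h.1], h.2⟩

/-- `δ · (1, 0) = δ → 0`. [folklore] -/
theorem tendsto_meshPoint_one :
    Tendsto (fun δ : ℝ => meshPoint δ ![1, 0]) (𝓝[>] (0 : ℝ)) (𝓝 0) := by
  have h : ∀ δ : ℝ, meshPoint δ ![1, 0] = (δ : ℂ) := fun δ => by
    rw [meshPoint_vec]; apply Complex.ext <;> simp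
  simp_rw [h]
  exact (Complex.continuous_ofReal.tendsto' 0 0 (by simp)).mono_left nhdsWithin_le_nhds

/-- **The honest endpoint approximation of a graph strip.**  For a Dobrushin domain whose
carrier is a graph strip and whose marked points are `0` and `1`, the axis sites `a_δ = (1, 0)`
and `b_δ = (⌈δ⁻¹⌉ - 1, 0)` form an endpoint approximation (joined in `Ω_δ` for every
`δ ∈ (0, 1)`, mesh points `δ → 0` and `δ(⌈δ⁻¹⌉ - 1) → 1`). [folklore] -/
theorem strip_isEndpointApprox {D : DobrushinDomain} {lo hi : ℝ → ℝ}
    (hΩ : ∀ z : ℂ, z ∈ D.carrier ↔ 0 < z.re ∧ z.re < 1 ∧ lo z.re < z.im ∧ z.im < hi z.re)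
    (hsign : ∀ x : ℝ, 0 < x → x < 1 → lo x < 0 ∧ 0 < hi x)
    (hhi : MonotoneOn hi (Icc 0 1)) (hlo : AntitoneOn lo (Icc 0 1))
    (h0 : D.pt 0 = 0) (h1 : D.pt 1 = 1) :
    SAW.IsEndpointApprox D (fun _ => ![1, 0]) (fun δ => ![⌈δ⁻¹⌉ - 1, 0]) := by
  refine ⟨?_, ?_, ?_⟩
  · filter_upwards [Ioo_mem_nhdsGT (by norm_num : (0 : ℝ) < 1)] with δ hδ
    have hb := stdA_bounds hδ.1 hδ.2
    exact strip_dd_reachable hΩ hsign hhi hlo hδ.1 hδ.2 (strip_one_mem hΩ hsign hδ.1 hδ.2)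
      (strip_axis_mem hΩ hsign hb.1 hb.2)
  · rw [h0]; exact tendsto_meshPoint_one
  · rw [h1]; exact tendsto_meshPoint_stdA

end Summit.CriticalPhenomena.SAWScalingLimit.Theorems.ConfinementPositivity.Negative

end
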